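import Literature.MathematicalPhysics.QuantumLattice.Imbrie2016.LLA

/-!
# Imbrie (2016), Assumption LLA: on two sites the local level-velocity spreads cannot all vanish

CITATION HEADER (lean-in-tree rule 2026-08-18). J. Z. Imbrie, *On many-body localization for quantum spin chains*,
J. Stat. Phys. **163** (2016) 998–1048, doi 10.1007/s10955-016-1508-x, arXiv:1403.7837 [ImbrieJSP2016], eq. (1.1) (the local
diagonal operators S^z_i, S^z_{i-1} S^z_i through which the random fields h_i and bonds J_i enter), eq. (1.3) (Assumption LLA).

WHAT IS PROVED (a lemma of the audit cell `pub-imbrie`, NOT a statement of the paper; pub-imbrie LLA.md gen-4 G3/G4′).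
In the level-velocity reformulation of LLA (LLA.md gen-4 G), an adjacent eigenpair (ψ, φ) of a resonant cluster is split to first or
second order in the direction of a coupling with diagonal operator V unless the compression of V to span(ψ, φ) is a multiple of the
identity, i.e. unless `⟨ψ,Vψ⟩ - ⟨φ,Vφ⟩ = 0` and `⟨ψ,Vφ⟩ = 0` ("vanishing spread"). `twoSite_localSpreads_ne_zero` shows that on a
TWO-site cluster this cannot happen for all three local operators Z₁, Z₂, Z₁Z₂ simultaneously: for real orthonormal u ⊥ v on the four
configurations, the six numbers Σ_σ s_V(σ)(u_σ² - v_σ²), Σ_σ s_V(σ) u_σ v_σ (V = Z₁, Z₂, Z₁Z₂) are not all zero — because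
{1, s_{Z₁}, s_{Z₂}, s_{Z₁Z₂}} is the complete Walsh basis of ℝ⁴. (From three sites on, the 2m local operators no longer span the
diagonal algebra and all local spreads CAN vanish: LLA.md gen-4 G4′(b).) `szZ_cfg_two_zero/one` identify the paper's `szZ σ 0`,
`szZ σ 1` on a 2-site box with the signs used here, and `twoSite_localSpreads_ne_zero_szZ` restates the result with them.

STATUS: elementary real linear algebra; says NOTHING about whether LLA holds (OPEN, pub-imbrie LLA.md §7). No `sorry`, no new
axioms, no new definitions.
-/

namespace Literature.MathematicalPhysics.QuantumLattice.Imbrie2016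

open Finset

/-- a sum over the four configurations of a 2-site box, written out. [cite: ImbrieJSP2016, eq. (1.1)] -/
theorem sum_cfg_two (f : Cfg 2 → ℝ) :
    ∑ σ, f σ = f ![true, true] + f ![true, false] + f ![false, true] + f ![false, false] := by
  rw [← Fintype.sum_equiv (finTwoArrowEquiv Bool).symm (fun p => f ((finTwoArrowEquiv Bool).symm p)) f (fun _ => rfl),
    Fintype.sum_prod_type]
  simp only [Fintype.sum_bool, finTwoArrowEquiv_symm_apply]
  ring

/-- if `a² = b²` and `a b = 0` then `a = 0`. [cite: ImbrieJSP2016, eq. (1.1)] -/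
theorem eq_zero_of_sq_eq_sq_of_mul_eq_zero {a b : ℝ} (hw : a ^ 2 = b ^ 2) (hz : a * b = 0) : a = 0 := by
  have h4 : (a ^ 2) ^ 2 = 0 := by
    calc (a ^ 2) ^ 2 = a ^ 2 * a ^ 2 := pow_two _
      _ = a ^ 2 * b ^ 2 := by rw [hw]
      _ = (a * b) ^ 2 := by ring
      _ = 0 := by rw [hz]; ring
  have h2 : a ^ 2 = 0 := (pow_eq_zero_iff (n := 2) (by norm_num)).mp h4
  exact (pow_eq_zero_iff (n := 2) (by norm_num)).mp h2

/-- On a two-site cluster the local spreads cannot all vanish: for orthonormal `u ⊥ v : Cfg 2 → ℝ` the six quantities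
`Σ s_V (u² - v²)`, `Σ s_V u v`, `V ∈ {Z₁, Z₂, Z₁Z₂}`, are not all zero (Walsh completeness). [cite: ImbrieJSP2016, eq. (1.1), (1.3)] -/
theorem twoSite_localSpreads_ne_zero (u v : Cfg 2 → ℝ)
    (hu : ∑ σ, u σ ^ 2 = 1) (hv : ∑ σ, v σ ^ 2 = 1) (huv : ∑ σ, u σ * v σ = 0)
    (h1w : ∑ σ, (if σ 0 then (1 : ℝ) else -1) * (u σ ^ 2 - v σ ^ 2) = 0)
    (h1z : ∑ σ, (if σ 0 then (1 : ℝ) else -1) * (u σ * v σ) = 0)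
    (h2w : ∑ σ, (if σ 1 then (1 : ℝ) else -1) * (u σ ^ 2 - v σ ^ 2) = 0)
    (h2z : ∑ σ, (if σ 1 then (1 : ℝ) else -1) * (u σ * v σ) = 0)
    (h3w : ∑ σ, ((if σ 0 then (1 : ℝ) else -1) * (if σ 1 then (1 : ℝ) else -1)) * (u σ ^ 2 - v σ ^ 2) = 0)
    (h3z : ∑ σ, ((if σ 0 then (1 : ℝ) else -1) * (if σ 1 then (1 : ℝ) else -1)) * (u σ * v σ) = 0) : False := by
  simp only [sum_cfg_two, Matrix.cons_val_zero, Matrix.cons_val_one, Bool.false_eq_true,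
    if_true, if_false] at hu hv huv h1w h1z h2w h2z h3w h3z
  have w1 : u ![true, true] ^ 2 = v ![true, true] ^ 2 := by linarith
  have w2 : u ![true, false] ^ 2 = v ![true, false] ^ 2 := by linarith
  have w3 : u ![false, true] ^ 2 = v ![false, true] ^ 2 := by linarith
  have w4 : u ![false, false] ^ 2 = v ![false, false] ^ 2 := by linarith
  have z1 : u ![true, true] * v ![true, true] = 0 := by linarith
  have z2 : u ![true, false] * v ![true, false] = 0 := by linarith
  have z3 : u ![false, true] * v ![false, true] = 0 := by linarith
  have z4 : u ![false, false] * v ![false, false] = 0 := by linarith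
  have e1 := eq_zero_of_sq_eq_sq_of_mul_eq_zero w1 z1
  have e2 := eq_zero_of_sq_eq_sq_of_mul_eq_zero w2 z2
  have e3 := eq_zero_of_sq_eq_sq_of_mul_eq_zero w3 z3
  have e4 := eq_zero_of_sq_eq_sq_of_mul_eq_zero w4 z4
  rw [e1, e2, e3, e4] at hu
  norm_num at hu

/-- on a 2-site box, `szZ σ 0` is the sign of the first spin. [cite: ImbrieJSP2016, eq. (1.1)] -/
theorem szZ_cfg_two_zero (σ : Cfg 2) : szZ σ 0 = if σ 0 then (1 : ℝ) else -1 := by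
  unfold szZ
  simp

/-- on a 2-site box, `szZ σ 1` is the sign of the second spin. [cite: ImbrieJSP2016, eq. (1.1)] -/
theorem szZ_cfg_two_one (σ : Cfg 2) : szZ σ 1 = if σ 1 then (1 : ℝ) else -1 := by
  unfold szZ
  simp

/-- `twoSite_localSpreads_ne_zero` in the paper's notation `szZ`. [cite: ImbrieJSP2016, eq. (1.1), (1.3)] -/
theorem twoSite_localSpreads_ne_zero_szZ (u v : Cfg 2 → ℝ)
    (hu : ∑ σ, u σ ^ 2 = 1) (hv : ∑ σ, v σ ^ 2 = 1) (huv : ∑ σ, u σ * v σ = 0)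
    (h1w : ∑ σ, szZ σ 0 * (u σ ^ 2 - v σ ^ 2) = 0) (h1z : ∑ σ, szZ σ 0 * (u σ * v σ) = 0)
    (h2w : ∑ σ, szZ σ 1 * (u σ ^ 2 - v σ ^ 2) = 0) (h2z : ∑ σ, szZ σ 1 * (u σ * v σ) = 0)
    (h3w : ∑ σ, (szZ σ 0 * szZ σ 1) * (u σ ^ 2 - v σ ^ 2) = 0)
    (h3z : ∑ σ, (szZ σ 0 * szZ σ 1) * (u σ * v σ) = 0) : False := by
  simp only [szZ_cfg_two_zero, szZ_cfg_two_one] at h1w h1z h2w h2z h3w h3z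
  exact twoSite_localSpreads_ne_zero u v hu hv huv h1w h1z h2w h2z h3w h3z

end Literature.MathematicalPhysics.QuantumLattice.Imbrie2016
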